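import Literature.Barriers.CriticalPhenomena.PositionSpaceRGNonGibbsianChessboard
import HarnessLib

/-!
# The abstract chessboard estimate on a block torus of arbitrary EVEN side

The tree's `Literature.Barriers.CriticalPhenomena.NonGibbs.chessboard_pow_le` proves the abstract
(set-function) chessboard estimate of Fröhlich–Israel–Lieb–Simon on the block torus `(ℤ/Nℤ)^d`
for DYADIC sides `N = 2^(n+1)`, by doubling runs of consecutive blocks. This file removes the
dyadic restriction: for every EVEN `N ≥ 2`, a non-negative set function `ψ` with `ψ ∅ ≤ 1`,
`ψ univ > 0` and the reflection Cauchy–Schwarz inequalities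
`ψ S ^ 2 ≤ ψ (symP i k S) · ψ (symM i k S)` satisfies `ψ S ^ (N^d) ≤ ψ univ ^ #S` for every `S`
(Fröhlich–Israel–Lieb–Simon 1978, Thm. 4.1, stated for all even tori; Biskup 2009, Thm. 5.8).

Proof: the same extremal argument (a maximiser `S*` of `Φ S = ψ S ^ (N^d) / ψ univ ^ #S`; both
symmetrisations of a maximiser are maximisers), with ONE extra move per axis. Doubling a run
`1 → 2 → ⋯ → 2^J → 2^(J+1)` works as long as `2^J ≤ N/2` (`exists_isMax_axisRun_succ`); with `J`
maximal, the run of `2^(J+1) > N/2` blocks need not be the full line when `N` is not a power of two,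
but it then CONTAINS the whole positive half-line `{(cᵢ - t₀ᵢ).val < N/2}` of the reflection through
the block boundary at its start `t₀ᵢ`, so the positive symmetrisation `symP i (t₀ i)` of that
maximiser contains `H₊ ∪ θH₊ =` the full line (`boxRun t₀ (i+1)`), and is again a maximiser
(`chessPhi_symP_eq_of_isMax`). Iterating over the `d` axes gives a maximiser equal to `univ`, where
`Φ = 1`.

## Main results

* `chessPhi_symP_eq_of_isMax` — the positive-half twin of the tree's `chessPhi_symM_eq_of_isMax`.
* `exists_isMax_boxRun_succ_even` — growing a maximiser along one axis, any even `N`.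
* `chessboard_pow_le_even`, `chessboard_le_rpow_even` — the chessboard estimate for even `N`.

## References

* J. Fröhlich, R. Israel, E. H. Lieb, B. Simon, Comm. Math. Phys. 62 (1978) 1–34, Thm. 4.1
  [FrohlichIsraelLiebSimon1978].
* S. Friedli, Y. Velenik, *Statistical Mechanics of Lattice Systems*, CUP 2017, Theorem 10.11
  [FriedliVelenik2017].
* M. Biskup, *Reflection positivity and phase transitions in lattice spin models*, LNM 1970 (2009),
  Thm. 5.8 [Biskup2009].
-/

noncomputable section

namespace Literature.Probability.LatticeModels

open Finset
open Literature.Barriers.CriticalPhenomena.NonGibbs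

variable {d N : ℕ} [NeZero N]

/-- Membership in the positive symmetrisation. [cite: FriedliVelenik2017, Theorem 10.11 (proof)] -/
theorem mem_symP_of_mem (i : Fin d) (k : ZMod N) {S : Finset (BlockIdx d N)} {c : BlockIdx d N}
    (hcS : c ∈ S) (hc : c ∈ halfPlus N i k) : c ∈ symP i k S :=
  mem_union_left _ (mem_inter.2 ⟨hcS, hc⟩)

/-- The reflection of a positive-half element of `S` lies in the positive symmetrisation.
[cite: FriedliVelenik2017, Theorem 10.11 (proof)] -/
theorem cellReflect_mem_symP_of_mem (i : Fin d) (k : ZMod N) {S : Finset (BlockIdx d N)}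
    {c : BlockIdx d N} (hcS : c ∈ S) (hc : c ∈ halfPlus N i k) :
    cellReflect i k c ∈ symP i k S :=
  mem_union_right _ (mem_image.2 ⟨c, mem_inter.2 ⟨hcS, hc⟩, rfl⟩)

/-- **The positive symmetrisation of a maximiser of `Φ` is a maximiser** (twin of the tree's
`chessPhi_symM_eq_of_isMax`). [cite: FriedliVelenik2017, Theorem 10.11 (proof)] -/
theorem chessPhi_symP_eq_of_isMax (hN : Even N) {ψ : Finset (BlockIdx d N) → ℝ} (h0 : ∀ S, 0 ≤ ψ S)
    (h1 : 0 < ψ univ)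
    (hcs : ∀ (i : Fin d) (k : ZMod N) (S : Finset (BlockIdx d N)),
      ψ S ^ 2 ≤ ψ (symP i k S) * ψ (symM i k S))
    {M : ℝ} (hMpos : 0 < M) (hmax : ∀ S, chessPhi ψ S ≤ M) {S : Finset (BlockIdx d N)}
    (hS : chessPhi ψ S = M) (i : Fin d) (k : ZMod N) :
    chessPhi ψ (symP i k S) = M := by
  have hP0 : 0 ≤ chessPhi ψ (symP i k S) := by
    unfold chessPhi; exact div_nonneg (pow_nonneg (h0 _) _) (pow_nonneg h1.le _)
  have hM0 : 0 ≤ chessPhi ψ (symM i k S) := by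
    unfold chessPhi; exact div_nonneg (pow_nonneg (h0 _) _) (pow_nonneg h1.le _)
  have h := chessPhi_sq_le hN h1 hcs i k S
  rw [hS] at h
  have hMle := hmax (symM i k S)
  refine le_antisymm (hmax _) ?_
  by_contra hlt
  rw [not_le] at hlt
  have h1' : chessPhi ψ (symP i k S) * chessPhi ψ (symM i k S) ≤ chessPhi ψ (symP i k S) * M :=
    mul_le_mul_of_nonneg_left hMle hP0
  have h2' : chessPhi ψ (symP i k S) * M < M * M := mul_lt_mul_of_pos_right hlt hMpos
  nlinarith

/-- **Closing a long run**: if a maximiser contains a run `axisRun t₀ i j` of `2^j ≥ N/2` blocks,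
then its positive symmetrisation through the block boundary `t₀ i` (a maximiser) contains the full
line `boxRun t₀ (i+1)`: the run contains the positive half-line, whose union with its reflection is
the whole line (even `N`). [cite: FriedliVelenik2017, Theorem 10.11 (proof)] -/
theorem boxRun_succ_subset_symP (hN : Even N) {t₀ : BlockIdx d N} {i : Fin d} {j : ℕ}
    (hj : N / 2 ≤ 2 ^ j) {S : Finset (BlockIdx d N)} (hrun : axisRun t₀ i j ⊆ S) :
    boxRun t₀ (i.val + 1) ⊆ symP i (t₀ i) S := by
  intro c hc
  rw [mem_boxRun] at hc
  -- coordinates above `i` agree with `t₀`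
  have habove : ∀ i' : Fin d, i.val < i'.val → c i' = t₀ i' := fun i' hi' => hc i' hi'
  by_cases hpos : (c i - t₀ i).val < N / 2
  · -- `c` itself is in the positive half-line, hence in the run
    exact mem_symP_of_mem i (t₀ i) (hrun (mem_axisRun.2 ⟨habove, lt_of_lt_of_le hpos hj⟩))
      (mem_halfPlus.2 hpos)
  · -- `c` is in the negative half-line: its reflection is in the positive half-line, in the run
    have hcm : c ∈ halfMinus N i (t₀ i) := mem_halfMinus.2 (not_lt.1 hpos)
    have hθ : cellReflect i (t₀ i) c ∈ halfPlus N i (t₀ i) := cellReflect_mem_halfPlus hN hcm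
    have hθrun : cellReflect i (t₀ i) c ∈ axisRun t₀ i j := by
      refine mem_axisRun.2 ⟨fun i' hi' => ?_, lt_of_lt_of_le (mem_halfPlus.1 hθ) hj⟩
      rw [cellReflect_apply_of_ne _ _ _ (fun h => by rw [h] at hi'; exact lt_irrefl _ hi')]
      exact habove i' hi'
    have := cellReflect_mem_symP_of_mem i (t₀ i) (hrun hθrun) hθ
    rwa [cellReflect_cellReflect] at this

/-- **Growing a maximiser along one axis, any even side**: if a maximiser contains `boxRun t₀ i`
then some maximiser contains `boxRun t₀ (i+1)` — double the run while `2^J ≤ N/2`, then close the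
line through the boundary at its start. [cite: FriedliVelenik2017, Theorem 10.11 (proof)] -/
theorem exists_isMax_boxRun_succ_even (hN : Even N) {ψ : Finset (BlockIdx d N) → ℝ}
    (h0 : ∀ S, 0 ≤ ψ S) (h1 : 0 < ψ univ)
    (hcs : ∀ (i : Fin d) (k : ZMod N) (S : Finset (BlockIdx d N)),
      ψ S ^ 2 ≤ ψ (symP i k S) * ψ (symM i k S))
    {M : ℝ} (hMpos : 0 < M) (hmax : ∀ S, chessPhi ψ S ≤ M) {t₀ : BlockIdx d N} (i : Fin d)
    {S : Finset (BlockIdx d N)} (hS : chessPhi ψ S = M) (hbox : boxRun t₀ i.val ⊆ S) :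
    ∃ S' : Finset (BlockIdx d N), chessPhi ψ S' = M ∧ boxRun t₀ (i.val + 1) ⊆ S' := by
  -- the largest `J` with `2^J ≤ N/2` (exists: `2^0 = 1 ≤ N/2` since `N ≥ 2` is even and non-zero)
  have hN2 : 1 ≤ N / 2 := by
    obtain ⟨m, hm⟩ := hN
    have := NeZero.ne N
    omega
  classical
  let J : ℕ := Nat.findGreatest (fun j => 2 ^ j ≤ N / 2) N
  have hJle : 2 ^ J ≤ N / 2 := by
    have h0 : (fun j => 2 ^ j ≤ N / 2) 0 := by simpa using hN2
    exact Nat.findGreatest_spec (P := fun j => 2 ^ j ≤ N / 2) (Nat.zero_le N) h0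
  have hJlt : N / 2 < 2 ^ (J + 1) := by
    by_contra hle
    rw [not_lt] at hle
    -- then `J + 1 ≤ N` would be a larger witness
    have hJ1N : J + 1 ≤ N := by
      have : 2 ^ (J + 1) ≤ N := hle.trans (Nat.div_le_self N 2)
      exact (Nat.lt_two_pow_self).le.trans this |> fun h => by
        have := Nat.lt_two_pow_self (n := J + 1)
        omega
    have := Nat.le_findGreatest (P := fun j => 2 ^ j ≤ N / 2) hJ1N hle
    change J + 1 ≤ J at this
    omega
  -- double the run `J + 1` times
  have key : ∀ j : ℕ, j ≤ J + 1 →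
      ∃ S' : Finset (BlockIdx d N), chessPhi ψ S' = M ∧ axisRun t₀ i j ⊆ S' := by
    intro j
    induction j with
    | zero => exact fun _ => ⟨S, hS, by rw [axisRun_zero]; exact hbox⟩
    | succ j ih =>
      intro hj
      obtain ⟨S', hS', hrun⟩ := ih (Nat.le_of_succ_le hj)
      have h2 : 2 ^ (j + 1) ≤ N := by
        have hjJ : j ≤ J := Nat.le_of_succ_le_succ hj
        calc 2 ^ (j + 1) = 2 * 2 ^ j := by rw [pow_succ, mul_comm]
          _ ≤ 2 * 2 ^ J := Nat.mul_le_mul_left 2 (Nat.pow_le_pow_right (by norm_num) hjJ)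
          _ ≤ 2 * (N / 2) := Nat.mul_le_mul_left 2 hJle
          _ ≤ N := Nat.mul_div_le N 2
      exact exists_isMax_axisRun_succ hN h0 h1 hcs hMpos hmax h2 hS' hrun
  obtain ⟨S', hS', hrun⟩ := key (J + 1) le_rfl
  -- close the line through the boundary at the start of the run
  exact ⟨symP i (t₀ i) S', chessPhi_symP_eq_of_isMax hN h0 h1 hcs hMpos hmax hS' i (t₀ i),
    boxRun_succ_subset_symP hN hJlt.le hrun⟩

/-- **The chessboard estimate, power form, for every EVEN side** (Fröhlich–Israel–Lieb–Simon 1978,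
Thm. 4.1; Friedli–Velenik Theorem 10.11; Biskup 2009, Thm. 5.8): if `ψ ≥ 0`, `ψ ∅ ≤ 1`,
`ψ univ > 0` and `ψ S ^ 2 ≤ ψ (symP i k S) ψ (symM i k S)` for all block reflections and all `S`,
then `ψ S ^ (N^d) ≤ ψ univ ^ #S`. [cite: FrohlichIsraelLiebSimon1978, Thm. 4.1] -/
theorem chessboard_pow_le_even (hN : Even N) {ψ : Finset (BlockIdx d N) → ℝ}
    (h0 : ∀ S, 0 ≤ ψ S) (hempty : ψ ∅ ≤ 1) (h1 : 0 < ψ univ)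
    (hcs : ∀ (i : Fin d) (k : ZMod N) (S : Finset (BlockIdx d N)),
      ψ S ^ 2 ≤ ψ (symP i k S) * ψ (symM i k S))
    (S : Finset (BlockIdx d N)) : ψ S ^ (N ^ d) ≤ ψ univ ^ #S := by
  classical
  obtain ⟨Smax, -, hSmax⟩ :=
    Finset.exists_max_image (univ : Finset (Finset (BlockIdx d N))) (chessPhi ψ) ⟨∅, mem_univ _⟩
  set M := chessPhi ψ Smax with hM
  have hmax : ∀ T, chessPhi ψ T ≤ M := fun T => hSmax T (mem_univ T)
  have hM1 : 1 ≤ M := by rw [← chessPhi_univ h1]; exact hmax _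
  have hMpos : 0 < M := one_pos.trans_le hM1
  have hMle : M ≤ 1 := by
    by_cases hne : Smax = ∅
    · rw [hM, hne, chessPhi, card_empty, pow_zero, div_one]
      exact pow_le_one₀ (h0 _) hempty
    · obtain ⟨t₀, ht₀⟩ := Finset.nonempty_iff_ne_empty.2 hne
      have grow : ∀ m : ℕ, m ≤ d →
          ∃ S' : Finset (BlockIdx d N), chessPhi ψ S' = M ∧ boxRun t₀ m ⊆ S' := by
        intro m
        induction m with
        | zero =>
          exact fun _ => ⟨Smax, rfl, by rw [boxRun_zero]; exact singleton_subset_iff.2 ht₀⟩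
        | succ m ih =>
          intro hm
          obtain ⟨S', hS', hbox⟩ := ih (Nat.le_of_succ_le hm)
          exact exists_isMax_boxRun_succ_even hN h0 h1 hcs hMpos hmax ⟨m, hm⟩ hS' hbox
      obtain ⟨S', hS', hbox⟩ := grow d le_rfl
      rw [boxRun_eq_univ] at hbox
      have : S' = univ := univ_subset_iff.1 hbox
      rw [← hS', this, chessPhi_univ h1]
  have hS : chessPhi ψ S ≤ 1 := (hmax S).trans hMle
  rw [chessPhi, div_le_one (pow_pos h1 _)] at hS
  exact hS

/-- **The chessboard estimate for every even side**, usual form `ψ S ≤ (ψ univ) ^ (#S / N^d)`.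
[cite: FrohlichIsraelLiebSimon1978, Thm. 4.1] -/
theorem chessboard_le_rpow_even (hN : Even N) {ψ : Finset (BlockIdx d N) → ℝ}
    (h0 : ∀ S, 0 ≤ ψ S) (hempty : ψ ∅ ≤ 1) (h1 : 0 < ψ univ)
    (hcs : ∀ (i : Fin d) (k : ZMod N) (S : Finset (BlockIdx d N)),
      ψ S ^ 2 ≤ ψ (symP i k S) * ψ (symM i k S))
    (S : Finset (BlockIdx d N)) : ψ S ≤ ψ univ ^ ((#S : ℝ) / (N : ℝ) ^ d) := by
  have hNd : (0 : ℝ) < (N : ℝ) ^ d := by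
    have : (0 : ℝ) < N := by exact_mod_cast Nat.pos_of_ne_zero (NeZero.ne N)
    positivity
  have h := chessboard_pow_le_even hN h0 hempty h1 hcs S
  have hroot : ψ S = (ψ S ^ (N ^ d)) ^ ((1 : ℝ) / (N : ℝ) ^ d) := by
    rw [← Real.rpow_natCast, ← Real.rpow_mul (h0 S)]
    push_cast
    rw [mul_one_div_cancel hNd.ne', Real.rpow_one]
  rw [hroot]
  calc (ψ S ^ N ^ d) ^ ((1 : ℝ) / (N : ℝ) ^ d)
      ≤ (ψ univ ^ #S) ^ ((1 : ℝ) / (N : ℝ) ^ d) :=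
        Real.rpow_le_rpow (pow_nonneg (h0 S) _) h (by positivity)
    _ = ψ univ ^ ((#S : ℝ) / (N : ℝ) ^ d) := by
        rw [← Real.rpow_natCast, ← Real.rpow_mul h1.le]
        congr 1
        ring

end Literature.Probability.LatticeModels

end
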